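import Summits.CriticalPhenomena.SAWScalingLimit.Theorems.SAWDefectDecoherenceBoundaryClosureRGateStabilityReflection
import Literature.Probability.RandomPlanarGeometry.CaratheodoryExtension
import HarnessLib

/-!
# `BoundaryClosureR` (stmt-CriticalPhenomena-14004), line `polygon-parity-squeeze`, stub
# `transportRigidity` (E), part F1: global facts on the Carathéodory extension of a frame

For a Dobrushin domain `D` (carrier `Ω`, root `a = D.pt 0`), a conformal frame `Φ : Ω → ℍₒ`
with `‖Φ‖ → ∞` at the root, and its injective Carathéodory extension `Φ*` to
`closure Ω ∖ {a}` (`GateStability.exists_frameExtension_injOn`), we record the compactness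
facts used by the identification step (E) of mechanism (A):

* `frameExt_bounded_off_root` — `Φ*` is bounded on `closure Ω` off any disc around the root;
* `frameExt_large_near_root` — `‖Φ*‖ → ∞` at the root within `closure Ω ∖ {a}`;
* `frameExt_localise` — `Φ* z` close to `Φ* c` forces `z` close to `c` (`c ≠ a`);
* `frame_localise_infty` — `‖Φ z‖` large forces `z` close to the root;
* `frameExt_surj_real` — every real number is a boundary value: `Φ* z = y` for some
  `z ∈ ∂Ω ∖ {a}` (take `zₙ = Φ⁻¹(y + i/n)` and a limit point in the compact `closure Ω`).

References: Pommerenke, *Boundary Behaviour of Conformal Maps* (1992), Thm. 2.6.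
-/

noncomputable section

open scoped Topology
open Filter Set Metric Complex
open UpperHalfPlane (upperHalfPlaneSet)
open Literature.Probability.RandomPlanarGeometry

namespace Summit.CriticalPhenomena.SAWScalingLimit.Theorems.PolygonParitySqueeze

namespace Transport

variable (D : DobrushinDomain) (Φ : ConformalEquiv D.carrier upperHalfPlaneSet)

/-- The root is not a point of the (open) carrier. [folklore] -/
theorem pt_zero_notMem_carrier : D.pt 0 ∉ D.carrier := fun h => by
  have := D.pt_mem_frontier 0
  rw [frontier, D.isOpen.interior_eq] at this
  exact this.2 h

/-- The carrier lies in `closure Ω ∖ {root}`. [folklore] -/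
theorem carrier_subset_closure_diff : D.carrier ⊆ closure D.carrier \ {D.pt 0} := fun _ hz =>
  ⟨subset_closure hz, fun h => pt_zero_notMem_carrier D (mem_singleton_iff.1 h ▸ hz)⟩

variable {D Φ}

/-- **`Φ*` is bounded off the root**: for `ε > 0` there is `R` with `‖Φ* z‖ ≤ R` for all
`z ∈ closure Ω` with `dist z a ≥ ε` (continuity on a compact set). [folklore] -/
theorem frameExt_bounded_off_root {Φs : ℂ → ℂ}
    (hΦsc : ContinuousOn Φs (closure D.carrier \ {D.pt 0})) {ε : ℝ} (hε : 0 < ε) :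
    ∃ R : ℝ, ∀ z ∈ closure D.carrier, ε ≤ dist z (D.pt 0) → ‖Φs z‖ ≤ R := by
  set K : Set ℂ := closure D.carrier ∩ (ball (D.pt 0) ε)ᶜ with hK
  have hKc : IsCompact K := D.toJordanDomain.isCompact_closure.inter_right isOpen_ball.isClosed_compl
  have hKsub : K ⊆ closure D.carrier \ {D.pt 0} := fun z hz =>
    ⟨hz.1, fun h => hz.2 (by rw [mem_singleton_iff.1 h]; exact mem_ball_self hε)⟩
  obtain ⟨R, hR⟩ := hKc.exists_bound_of_continuousOn (hΦsc.mono hKsub)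
  exact ⟨R, fun z hz hzε => hR z ⟨hz, fun h => not_lt.2 hzε (mem_ball.1 h)⟩⟩

/-- **`‖Φ*‖ → ∞` at the root within `closure Ω ∖ {a}`**: the divergence of `‖Φ‖` at the root
within `Ω` passes to the continuous extension by density. [folklore] -/
theorem frameExt_large_near_root (hΦ0 : Tendsto (fun z => ‖Φ z‖) (𝓝[D.carrier] (D.pt 0)) atTop)
    {Φs : ℂ → ℂ} (hΦsc : ContinuousOn Φs (closure D.carrier \ {D.pt 0}))
    (hΦse : EqOn Φs Φ D.carrier) (M : ℝ) :
    ∃ ε : ℝ, 0 < ε ∧ ∀ z ∈ closure D.carrier, z ≠ D.pt 0 → dist z (D.pt 0) < ε → M ≤ ‖Φs z‖ := by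
  have hev : ∀ᶠ w in 𝓝[D.carrier] (D.pt 0), M ≤ ‖Φ w‖ := (tendsto_atTop.1 hΦ0) M
  obtain ⟨ε, hε, hball⟩ := Metric.eventually_nhds_iff.1 (eventually_nhdsWithin_iff.1 hev)
  refine ⟨ε, hε, fun z hzcl hz0 hzε => ?_⟩
  set A : Set ℂ := D.carrier ∩ ball (D.pt 0) ε with hA
  have hAsub : A ⊆ closure D.carrier \ {D.pt 0} :=
    fun w hw => carrier_subset_closure_diff D hw.1
  have hzA : z ∈ closure A := by
    rw [hA, inter_comm]
    exact isOpen_ball.inter_closure ⟨mem_ball.2 hzε, hzcl⟩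
  haveI : NeBot (𝓝[A] z) := mem_closure_iff_nhdsWithin_neBot.1 hzA
  have hT : Tendsto (fun w => ‖Φs w‖) (𝓝[A] z) (𝓝 ‖Φs z‖) :=
    ((hΦsc z ⟨hzcl, fun h => hz0 (mem_singleton_iff.1 h)⟩).mono hAsub).tendsto.norm
  refine ge_of_tendsto hT ?_
  filter_upwards [self_mem_nhdsWithin] with w hw
  rw [hΦse hw.1]
  exact hball (mem_ball.1 hw.2) hw.1

/-- **Localisation by the boundary values**: for `c ∈ closure Ω ∖ {a}` and `ε > 0` there is
`r > 0` such that every `z ∈ closure Ω ∖ {a}` with `‖Φ* z - Φ* c‖ < r` satisfies `dist z c < ε`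
(injectivity and continuity of `Φ*` on the compact part of `closure Ω` away from the root, where
`‖Φ*‖` is large). [folklore] -/
theorem frameExt_localise (hΦ0 : Tendsto (fun z => ‖Φ z‖) (𝓝[D.carrier] (D.pt 0)) atTop)
    {Φs : ℂ → ℂ} (hΦsc : ContinuousOn Φs (closure D.carrier \ {D.pt 0}))
    (hΦse : EqOn Φs Φ D.carrier) (hΦsi : InjOn Φs (closure D.carrier \ {D.pt 0}))
    {c : ℂ} (hc : c ∈ closure D.carrier) (hc0 : c ≠ D.pt 0) {ε : ℝ} (hε : 0 < ε) :
    ∃ r : ℝ, 0 < r ∧ ∀ z ∈ closure D.carrier, z ≠ D.pt 0 → ‖Φs z - Φs c‖ < r → dist z c < ε := by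
  obtain ⟨ε₁, hε₁, hlarge⟩ := frameExt_large_near_root hΦ0 hΦsc hΦse (‖Φs c‖ + 1)
  set K : Set ℂ := closure D.carrier ∩ (ball (D.pt 0) ε₁)ᶜ ∩ (ball c ε)ᶜ with hK
  have hKc : IsCompact K :=
    (D.toJordanDomain.isCompact_closure.inter_right isOpen_ball.isClosed_compl).inter_right
      isOpen_ball.isClosed_compl
  have hKsub : K ⊆ closure D.carrier \ {D.pt 0} := fun z hz =>
    ⟨hz.1.1, fun h => hz.1.2 (by rw [mem_singleton_iff.1 h]; exact mem_ball_self hε₁)⟩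
  have hfc : ContinuousOn (fun z => ‖Φs z - Φs c‖) K :=
    ((hΦsc.mono hKsub).sub continuousOn_const).norm
  have hfpos : ∀ z ∈ K, 0 < ‖Φs z - Φs c‖ := by
    intro z hz
    refine norm_pos_iff.2 (sub_ne_zero.2 fun h => hz.2 ?_)
    have := hΦsi (hKsub hz) ⟨hc, fun h' => hc0 (mem_singleton_iff.1 h')⟩ h
    rw [this]; exact mem_ball_self hε
  -- the positive minimum of `‖Φ* - Φ* c‖` on `K` (or `1` if `K` is empty)
  obtain ⟨m, hm, hmK⟩ : ∃ m : ℝ, 0 < m ∧ ∀ z ∈ K, m ≤ ‖Φs z - Φs c‖ := by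
    rcases K.eq_empty_or_nonempty with hKe | hKne
    · exact ⟨1, one_pos, fun z hz => by rw [hKe] at hz; exact absurd hz (notMem_empty z)⟩
    · obtain ⟨z₁, hz₁, hmin⟩ := hKc.exists_isMinOn hKne hfc
      exact ⟨‖Φs z₁ - Φs c‖, hfpos z₁ hz₁, fun z hz => hmin hz⟩
  refine ⟨min 1 m, lt_min one_pos hm, fun z hzcl hz0 hzr => ?_⟩
  by_contra hfar
  push Not at hfar
  by_cases hnear : dist z (D.pt 0) < ε₁
  · have h1 := hlarge z hzcl hz0 hnear
    have h2 : ‖Φs z‖ - ‖Φs c‖ ≤ ‖Φs z - Φs c‖ := norm_sub_norm_le _ _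
    linarith [min_le_left (1 : ℝ) m]
  · have hzK : z ∈ K := ⟨⟨hzcl, fun h => hnear (mem_ball.1 h)⟩, fun h => not_lt.2 hfar (mem_ball.1 h)⟩
    linarith [hmK z hzK, min_le_right (1 : ℝ) m]

/-- **Localisation at infinity**: `‖Φ z‖` large forces `z ∈ Ω` to be close to the root.
[folklore] -/
theorem frame_localise_infty {Φs : ℂ → ℂ} (hΦsc : ContinuousOn Φs (closure D.carrier \ {D.pt 0}))
    (hΦse : EqOn Φs Φ D.carrier) {ε : ℝ} (hε : 0 < ε) :
    ∃ R : ℝ, ∀ z ∈ D.carrier, R < ‖Φ z‖ → dist z (D.pt 0) < ε := by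
  obtain ⟨R, hR⟩ := frameExt_bounded_off_root (D := D) hΦsc hε
  refine ⟨R, fun z hz hzR => ?_⟩
  by_contra hfar
  push Not at hfar
  have := hR z (subset_closure hz) hfar
  rw [hΦse hz] at this
  exact absurd hzR (not_lt.2 this)

/-- **Every real number is a boundary value of the frame**: for `y : ℝ` there is
`z ∈ ∂Ω ∖ {a}` with `Φ* z = y`.  (Let `zₙ = Φ⁻¹(y + i/(n+1))`; a limit point `z*` in the compact
`closure Ω` is not in `Ω` — `Φ z* = y` would be real —, is not the root — `‖Φ zₙ‖` stays bounded
—, hence is a frontier point off the root, where `Φ*` is continuous.) [folklore] -/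
theorem frameExt_surj_real (hΦ0 : Tendsto (fun z => ‖Φ z‖) (𝓝[D.carrier] (D.pt 0)) atTop)
    {Φs : ℂ → ℂ} (hΦsc : ContinuousOn Φs (closure D.carrier \ {D.pt 0}))
    (hΦse : EqOn Φs Φ D.carrier) (y : ℝ) :
    ∃ z ∈ frontier D.carrier, z ≠ D.pt 0 ∧ Φs z = y := by
  have hU : IsOpen D.carrier := D.isOpen
  -- the points `wₙ = y + i/(n+1) ∈ ℍ` and `zₙ = Φ⁻¹ wₙ ∈ Ω`
  set w : ℕ → ℂ := fun k => (y : ℂ) + ((1 / ((k : ℝ) + 1) : ℝ) : ℂ) * I with hw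
  have hwim : ∀ k, 0 < (w k).im := fun k => by
    simp only [hw, add_im, ofReal_im, mul_im, ofReal_re, I_im, mul_one, I_re, mul_zero,
      add_zero, zero_add]
    positivity
  have hwmem : ∀ k, w k ∈ upperHalfPlaneSet := hwim
  have hwlim : Tendsto w atTop (𝓝 (y : ℂ)) := by
    have h1 : Tendsto (fun k : ℕ => (1 / ((k : ℝ) + 1) : ℝ)) atTop (𝓝 0) :=
      tendsto_one_div_add_atTop_nhds_zero_nat
    have h2 : Tendsto (fun k : ℕ => (y : ℂ) + ((1 / ((k : ℝ) + 1) : ℝ) : ℂ) * I) atTop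
        (𝓝 ((y : ℂ) + ((0 : ℝ) : ℂ) * I)) :=
      tendsto_const_nhds.add (((continuous_ofReal.tendsto 0).comp h1).mul tendsto_const_nhds)
    have h3 : (y : ℂ) + ((0 : ℝ) : ℂ) * I = y := by simp
    rw [h3] at h2
    exact h2
  set z : ℕ → ℂ := fun k => Φ.symm (w k) with hz
  have hzmem : ∀ k, z k ∈ D.carrier := fun k => Φ.symm_mapsTo (hwmem k)
  have hΦz : ∀ k, Φ (z k) = w k := fun k => Φ.apply_symm_apply (hwmem k)
  -- a limit point `z*` of `zₙ` in the compact `closure Ω`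
  obtain ⟨zs, hzs, φ, hφ, hlim⟩ := D.toJordanDomain.isCompact_closure.tendsto_subseq
    (fun k => subset_closure (hzmem k))
  have hwφ : Tendsto (fun k => Φ (z (φ k))) atTop (𝓝 (y : ℂ)) := by
    simp only [hΦz]; exact hwlim.comp hφ.tendsto_atTop
  -- `z*` is not in `Ω`
  have hzsΩ : zs ∉ D.carrier := by
    intro h
    have h1 : Tendsto (fun k => Φ (z (φ k))) atTop (𝓝 (Φ zs)) :=
      ((Φ.continuousOn zs h).continuousAt (hU.mem_nhds h)).tendsto.comp hlim
    have h2 : Φ zs = y := tendsto_nhds_unique h1 hwφ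
    have h3 : 0 < (Φ zs).im := Φ.mapsTo h
    rw [h2, ofReal_im] at h3
    exact lt_irrefl _ h3
  -- `z*` is not the root
  have hlimW : Tendsto (fun k => z (φ k)) atTop (𝓝[D.carrier] zs) :=
    tendsto_nhdsWithin_iff.2 ⟨hlim, Eventually.of_forall fun k => hzmem _⟩
  have hzs0 : zs ≠ D.pt 0 := by
    intro h
    rw [h] at hlimW
    have h1 : Tendsto (fun k => ‖Φ (z (φ k))‖) atTop atTop := hΦ0.comp hlimW
    exact not_tendsto_atTop_of_tendsto_nhds hwφ.norm h1
  -- hence a frontier point off the root, where `Φ*` is continuous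
  have hfr : zs ∈ frontier D.carrier := by
    rw [frontier, hU.interior_eq]; exact ⟨hzs, hzsΩ⟩
  refine ⟨zs, hfr, hzs0, ?_⟩
  have hsub : D.carrier ⊆ closure D.carrier \ {D.pt 0} := carrier_subset_closure_diff D
  have h1 : Tendsto Φs (𝓝[D.carrier] zs) (𝓝 (Φs zs)) :=
    ((hΦsc zs ⟨hzs, fun h => hzs0 (mem_singleton_iff.1 h)⟩).mono hsub).tendsto
  have h2 : Tendsto (fun k => Φs (z (φ k))) atTop (𝓝 (Φs zs)) := h1.comp hlimW
  have h3 : Tendsto (fun k => Φs (z (φ k))) atTop (𝓝 (y : ℂ)) :=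
    hwφ.congr fun k => (hΦse (hzmem _)).symm
  exact tendsto_nhds_unique h2 h3

/-- On the upper half-plane, `Function.invFunOn Φ Ω` is the inverse frame `Φ⁻¹`. [folklore] -/
theorem invFunOn_frame_eq_symm {w : ℂ} (hw : w ∈ upperHalfPlaneSet) :
    Function.invFunOn Φ D.carrier w = Φ.symm w := by
  have h := Φ.injOn.leftInvOn_invFunOn (Φ.symm_mapsTo hw)
  rwa [Φ.apply_symm_apply hw] at h

/-! ### Registered form -/

/-- **Registered helper `transport_frameSurjReal`** (∀-closed form of `frameExt_surj_real`;
sub-goal F1 of stub `transportRigidity` (E), crux stmt-CriticalPhenomena-14004, line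
`polygon-parity-squeeze`). [cite: PommerenkeBBCM1992, Thm. 2.6] -/
theorem transport_frameSurjReal : ∀ (D : DobrushinDomain) (Φ : ConformalEquiv D.carrier UpperHalfPlane.upperHalfPlaneSet) (Φs : ℂ → ℂ), Filter.Tendsto (fun z => ‖Φ z‖) (𝓝[D.carrier] (D.pt 0)) Filter.atTop → ContinuousOn Φs (closure D.carrier \ {D.pt 0}) → Set.EqOn Φs Φ D.carrier → ∀ y : ℝ, ∃ z ∈ frontier D.carrier, z ≠ D.pt 0 ∧ Φs z = y :=
  fun _D _Φ _Φs hΦ0 hΦsc hΦse y => frameExt_surj_real hΦ0 hΦsc hΦse y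

end Transport

end Summit.CriticalPhenomena.SAWScalingLimit.Theorems.PolygonParitySqueeze
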